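import Summits.Ventures.PercRepro.ProfilePointedMovesLevel
import Summits.Ventures.PercRepro.ProfilePointedPGirth

/-!
# PercRepro — (A1κ⁺): THEOREM A ON `N − 1` ELEMENTS FOR THE CAPTURED PROFILE, ITS BLOCKED-MOVE FORM, AND
(A1κ⁺) + THEOREM A FOR `M / p` ⟹ CONJECTURE (D) (p10, gen 25)

Gen 15's (A1κ) `(N − k − 1)·κ_k ≤ k·κ_{k+1}` is FALSE (gen 21).  The weaker statement with Theorem A's own constants on
`N − 1` elements, **(A1κ⁺) `(N − k − 1)·κ_k ≤ (k + 1)·κ_{k+1}`** (`CapRowPlus`, NOT asserted), has 0 violations on every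
`(M, p, k)` of the ≤ 8 catalogue and on the refutation families of gens 14 / 21 ⊕ coloops (paper).  THIS FILE records

* `CapRowPlus` / `CapRowPlusAt` — the conjecture as a `Prop`;
* `capRowPlus_level_iff_blocked` — **(A1κ⁺) at level `k` ⟺ `Σ_{𝒦_k} #upBlocked ≤ Σ_{𝒦_{k+1}} #downBlocked`** (gen 16's
  identities; the refuted (A1κ) needed `+ κ_{k+1}` on the left);
* `avoidRow_level_of_capRowPlus_of_fact` — **(A1κ⁺) at `(M, p, k)` and Theorem A for `M / p` give conjecture (D) at
  `(M, p, k)`** (`out = κ + c^p` termwise), hence `avoidRowAt_of_capRowPlusAt_of_fact`.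

Nothing here asserts (A1κ⁺), (D) or (Ĉ).
-/

open scoped Matroid

namespace PercRepro.Cogirth

open Finset ThmH Skew

variable {α : Type} [DecidableEq α] {M : Matroid α} [M.Finite]

/-- **(A1κ⁺) (NOT asserted)**: `(N − k − 1)·κ_k ≤ (k + 1)·κ_{k+1}` for every finite matroid on `α`, every point and every
level `2k + 2 ≤ N`. -/
def CapRowPlus (α : Type) [DecidableEq α] : Prop :=
  ∀ (M : Matroid α) [M.Finite] (p : α) (k : ℕ), p ∈ gr M → 2 * k + 2 ≤ (gr M).card →
    ((gr M).card - k - 1) * capCount M k p ≤ (k + 1) * capCount M (k + 1) p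

/-- (A1κ⁺) at every level of one pointed matroid. -/
def CapRowPlusAt (M : Matroid α) [M.Finite] (p : α) : Prop :=
  ∀ k : ℕ, 2 * k + 2 ≤ (gr M).card → ((gr M).card - k - 1) * capCount M k p ≤ (k + 1) * capCount M (k + 1) p

/-- **THE BLOCKED-MOVE FORM OF (A1κ⁺)**: `(N − k − 1)·κ_k ≤ (k + 1)·κ_{k+1}` iff the blocked up-moves of level `k` are
at most the blocked down-moves of level `k + 1`. -/
theorem capRowPlus_level_iff_blocked {p : α} (hp : p ∈ gr M) (k : ℕ) :
    ((gr M).card - k - 1) * capCount M k p ≤ (k + 1) * capCount M (k + 1) p ↔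
      ∑ X ∈ (capSets M p).filter (fun X => X.card = k), (upBlocked M p X).card ≤
        ∑ X ∈ (capSets M p).filter (fun X => X.card = k + 1), (downBlocked M p X).card := by
  have hu := card_mul_capCount_eq_up (M := M) hp k
  have hd := succ_mul_capCount_eq_down (M := M) p k
  have he := sum_card_upMoves_eq_sum_card_downMoves_level (M := M) p k
  have hk : (gr M).card - k - 1 = (gr M).card - 1 - k := by omega
  rw [hk]
  omega

/-- A point that is not a loop has `rk {p} = 1`; a loop kills every profile. -/
theorem capCount_eq_zero_of_not_indep {p : α} (hp : p ∈ gr M) (hp1 : ¬ M.Indep {p}) (k : ℕ) :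
    capCount M k p = 0 := by
  have hr : rk M {p} = 0 := by
    have h1 := rk_le_card (M := M) ({p} : Finset α)
    rw [card_singleton] at h1
    rcases Nat.le_one_iff_eq_zero_or_eq_one.1 h1 with h | h
    · exact h
    · exfalso
      apply hp1
      have := indep_of_rk_eq_card' (M := M) (X := ({p} : Finset α)) (by rw [h, card_singleton])
      simpa using this
  have h0 := card_biIndepSets_eq_zero_of_loop hp hr k
  unfold capCount
  rw [card_eq_zero] at h0 ⊢
  rw [h0, filter_empty]

/-- **(A1κ⁺) AT `(M, p, k)` AND THEOREM A FOR `M / p` GIVE (D) AT `(M, p, k)`**: `out = κ + c^p` and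
`(N − k − 1)·c_k ≤ (k + 1)·c_{k+1}` (Theorem A for the contraction on `N − 1` elements). -/
theorem avoidRow_level_of_capRowPlus_of_fact (hfact : BiIndepDensityLogConcave α) {p : α} (hp : p ∈ gr M) {k : ℕ}
    (hk : 2 * k + 2 ≤ (gr M).card)
    (hcap : ((gr M).card - k - 1) * capCount M k p ≤ (k + 1) * capCount M (k + 1) p) :
    ((gr M).card - k - 1) * outCount M k p ≤ (k + 1) * outCount M (k + 1) p := by
  rw [← capCount_add_extCount k hp, ← capCount_add_extCount (k + 1) hp, mul_add, mul_add]
  apply Nat.add_le_add hcap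
  by_cases hp1 : M.Indep {p}
  · have := extCount_thmA_of_fact hfact hp hp1 k hk
    rwa [show (gr M).card - 1 - k = (gr M).card - k - 1 by omega] at this
  · rw [extCount_eq_zero_of_not_indep hp1 k, mul_zero]
    exact Nat.zero_le _

/-- (A1κ⁺) at every level of `(M, p)` gives (D) at every level of `(M, p)`, mod Theorem A. -/
theorem avoidRowAt_of_capRowPlusAt_of_fact (hfact : BiIndepDensityLogConcave α) {p : α} (hp : p ∈ gr M)
    (h : CapRowPlusAt M p) : AvoidRowAt M p :=
  fun k hk => avoidRow_level_of_capRowPlus_of_fact hfact hp hk (h k hk)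

end PercRepro.Cogirth
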